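import Summits.CriticalPhenomena.PercolationContinuityZ3.Theorems.PercAnnulusCrossingIICMeasureCorollaries
import Summits.CriticalPhenomena.PercolationContinuityZ3.Theorems.PercAnnulusCrossingIICPlanarColumn
import HarnessLib

/-!
# Kesten's IIC does not depend on the exhaustion: `P_p(E | 0 ↔ ∂ⁱⁿW_n in W_n) → ν(E)` for ANY `W_n ⊇ Λ(r_n)`, `r_n → ∞` (lane RSW3, p1 gen 7)

builds on p205010 (kernel theorem, internal audit signed; external expert review pending) — used only by the `p_c(ℤ^d)` statement
(`θ(p_c) = 0` through `CSH.percolationContinuity_allDimensions`); the general-`p` statement and the `ℤ²` statement do not use it.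

Seat `prim-rsw3-p1` (gen 7).  The tree's IIC measure `ν` is the limit of `P_p(· | 0 ↔ ∂ⁱⁿΛ(n))` along the sup-norm boxes `Λ(n)`.
Basu–Sapozhnikov's Remark 2.1 — in the tree as the uniform admissible-conditioning clause of
`iicMeasure_properties_of_setToSetQuasiMultAspectAt` — says much more, and this file spells out the cleanest consequence: the limit is
the same along EVERY exhaustion of `ℤ^d` by finite vertex sets.  For finite `W ⊇ Λ(n₀)` the conditioning `{0 ↔ ∂ⁱⁿW in W}` is admissible:
`∂ⁱⁿW` misses `Λ(n₀ − 1)`, and from every `x ∈ ∂ⁱⁿΛ(n₀)` the straight lattice RAY in the outward coordinate direction stays outside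
`Λ(n₀ − 1)`, inside `W` until it first leaves `W`, and leaves it through a point of `∂ⁱⁿW` (`exists_walk_to_innerBoundary_of_box_subset`).

* `exists_ray_of_mem_innerBoundary_box` — from `x ∈ ∂ⁱⁿΛ(n)` a lattice direction `e` with `|(x + k·e)_i| = n + k` for all `k`;
* `exists_walk_to_innerBoundary_of_box_subset` — for finite `W ⊇ Λ(n)`, `n ≥ 1`, `x ∈ ∂ⁱⁿΛ(n)`: some `t ∈ ∂ⁱⁿW` and a lattice walk
  `x → t` inside `W ∖ Λ(n − 1)`;
* **`iicMeasure_tendsto_cond_exhaustion`** — `d ≥ 1`, `0 < p`, `θ(p) = 0`, (A2)□ at aspect `(s,L)`: for every measure `ν` with the IIC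
  limit property, every sequence of finite `W_n ⊇ Λ(r_n)` with `r_n → ∞` and every cylinder event `E`:
  **`P_p(E ∩ {0 ↔ ∂ⁱⁿW_n in W_n}) / P_p(0 ↔ ∂ⁱⁿW_n in W_n) → ν(E)`**;
* **`iicMeasure_tendsto_cond_exhaustion_criticalProbI`** — the same at `p_c(ℤ^d)`, `d ≥ 2`, under (A2)□ at one aspect;
* **`iicMeasure_tendsto_cond_exhaustion_Z2`** — the same at `p_c(ℤ²) = 1/2`, unconditionally (graph-metric balls, translated or
  lopsided boxes, arbitrary finite domains swallowing every box: all give Kesten's IIC).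

Helper file for the crux `stmt-CriticalPhenomena-4575` chain; no definitions, no sorries.
References: D. Basu, A. Sapozhnikov, ECP 22 (2017) no. 26, Thm. 1.1 and Remark 2.1; H. Kesten, PTRF 73 (1986) 369–394, Thm. (3).
-/

noncomputable section

namespace Summit.CriticalPhenomena.PercolationContinuityZ3.Theorems.Crossing

open MeasureTheory ProbabilityTheory Filter Topology
open Literature.Probability.Percolation Literature.Probability.LatticeModels
open Literature.Probability.Percolation.DCT16
open scoped ENNReal

variable {d : ℕ}

/-! ## §1 A ray out of a box -/

/-- A site with a coordinate of absolute value `> m` lies outside `Λ(m)`. [folklore] -/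
theorem not_mem_box_of_lt_abs {m : ℕ} {z : Site d} {i : Fin d} (h : (m : ℤ) < |z i|) : z ∉ box d m := by
  intro hz
  rw [mem_box] at hz
  have h1 := hz i
  have h2 : |z i| ≤ m := abs_le.2 ⟨h1.1, h1.2⟩
  exact absurd h (not_lt.2 h2)

/-- **A ray out of a box**: from every `x ∈ ∂ⁱⁿΛ(n)` there is a lattice step `e` (every `a` is adjacent to `a + e`) and a coordinate `i`
with `|(x + k·e)_i| = n + k` for every `k` — the outward coordinate direction at `x`. [folklore] -/
theorem exists_ray_of_mem_innerBoundary_box {n : ℕ} {x : Site d} (hx : x ∈ innerBoundary (zdGraph d) (box d n)) :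
    ∃ e : Site d, (∀ a : Site d, (zdGraph d).Adj a (a + e)) ∧ ∃ i : Fin d, ∀ k : ℕ, |(x + k • e) i| = n + k := by
  obtain ⟨i, hi⟩ := exists_eq_of_mem_innerBoundary_box hx
  rcases hi with hi | hi
  · refine ⟨(Pi.single i (1 : ℤ) : Site d), fun a => (zdGraph_adj_iff _ _).2 ⟨i, Or.inl rfl⟩, i, fun k => ?_⟩
    have h1 : (x + k • (Pi.single i (1 : ℤ) : Site d)) i = (n : ℤ) + k := by
      rw [Pi.add_apply, Pi.smul_apply, Pi.single_eq_same, hi, nsmul_eq_mul, mul_one]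
    rw [h1]
    exact abs_of_nonneg (by positivity)
  · refine ⟨-(Pi.single i (1 : ℤ) : Site d), fun a => (zdGraph_adj_iff _ _).2 ⟨i, Or.inr ?_⟩, i, fun k => ?_⟩
    · rw [add_assoc, neg_add_cancel, add_zero]
    · have h1 : (x + k • (-(Pi.single i (1 : ℤ) : Site d))) i = -((n : ℤ) + k) := by
        rw [Pi.add_apply, Pi.smul_apply, Pi.neg_apply, Pi.single_eq_same, hi, smul_neg, nsmul_eq_mul, mul_one, neg_add]
      rw [h1, abs_neg]
      exact abs_of_nonneg (by positivity)

/-- **Exit of the ray**: for a finite `W ⊇ Λ(n)` (`n ≥ 1`) and `x ∈ ∂ⁱⁿΛ(n)` there are `t ∈ ∂ⁱⁿW` and a lattice walk from `x` to `t` all of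
whose vertices lie in `W ∖ Λ(n − 1)` (follow the outward ray from `x` and stop just before it first leaves `W`). [folklore] -/
theorem exists_walk_to_innerBoundary_of_box_subset {n : ℕ} (hn : 1 ≤ n) {W : Finset (Site d)} (hW : box d n ⊆ W) {x : Site d}
    (hx : x ∈ innerBoundary (zdGraph d) (box d n)) :
    ∃ t ∈ innerBoundary (zdGraph d) W, ∃ q : (zdGraph d).Walk x t,
      ∀ z ∈ q.support, z ∈ (↑W : Set (Site d)) \ ↑(box d (n - 1)) := by
  classical
  obtain ⟨e, hadj, i, hray⟩ := exists_ray_of_mem_innerBoundary_box hx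
  -- the ray avoids `Λ(n-1)`
  have hout : ∀ k : ℕ, x + k • e ∉ box d (n - 1) := fun k =>
    not_mem_box_of_lt_abs (i := i) (by rw [hray k]; omega)
  -- the ray leaves `W`
  have hexit : ∃ k : ℕ, x + (k + 1) • e ∉ W := by
    refine ⟨W.sup Site.supNorm, fun hmem => ?_⟩
    have h1 : Site.supNorm (x + (W.sup Site.supNorm + 1) • e) ≤ W.sup Site.supNorm := Finset.le_sup (f := Site.supNorm) hmem
    exact not_mem_box_of_lt_abs (i := i) (by rw [hray (W.sup Site.supNorm + 1)]; push_cast; omega)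
      (mem_box_iff_supNorm_le.2 h1)
  set K := Nat.find hexit with hK
  have hKout : x + (K + 1) • e ∉ W := Nat.find_spec hexit
  have hin : ∀ j ≤ K, x + j • e ∈ W := by
    intro j hj
    rcases j with _ | j
    · rw [zero_nsmul, add_zero]
      exact hW (mem_innerBoundary_iff.1 hx).1
    · by_contra h
      exact Nat.find_min hexit (show j < K by omega) h
  have hstep : ∀ k : ℕ, (zdGraph d).Adj (x + k • e) (x + (k + 1) • e) := fun k => by
    rw [succ_nsmul, ← add_assoc]
    exact hadj _
  refine ⟨x + K • e, mem_innerBoundary_iff.2 ⟨hin K le_rfl, x + (K + 1) • e, hKout, hstep K⟩, ?_⟩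
  -- the walk along the ray
  suffices hwalk : ∀ k ≤ K, ∃ q : (zdGraph d).Walk x (x + k • e), ∀ z ∈ q.support, ∃ j ≤ k, z = x + j • e by
    obtain ⟨q, hq⟩ := hwalk K le_rfl
    refine ⟨q, fun z hz => ?_⟩
    obtain ⟨j, hj, rfl⟩ := hq z hz
    exact ⟨Finset.mem_coe.2 (hin j hj), fun h => hout j (Finset.mem_coe.1 h)⟩
  intro k hk
  induction k with
  | zero =>
    refine ⟨(SimpleGraph.Walk.nil : (zdGraph d).Walk x x).copy rfl (by rw [zero_nsmul, add_zero]), fun z hz => ⟨0, le_rfl, ?_⟩⟩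
    rw [SimpleGraph.Walk.support_copy, SimpleGraph.Walk.support_nil, List.mem_singleton] at hz
    rw [hz, zero_nsmul, add_zero]
  | succ k ih =>
    obtain ⟨q, hq⟩ := ih (by omega)
    refine ⟨q.concat (hstep k), fun z hz => ?_⟩
    rw [SimpleGraph.Walk.support_concat, List.mem_append, List.mem_singleton] at hz
    rcases hz with hz | rfl
    · obtain ⟨j, hj, rfl⟩ := hq z hz
      exact ⟨j, by omega, rfl⟩
    · exact ⟨k + 1, le_rfl, rfl⟩

/-- The inner boundary of a finite `W ⊇ Λ(n₀)` misses `Λ(n₀ − 1)` (`n₀ ≥ 1`): a neighbour of a point of `Λ(n₀ − 1)` lies in `Λ(n₀) ⊆ W`.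
[folklore] -/
theorem not_mem_box_pred_of_mem_innerBoundary {n₀ : ℕ} (hn₀ : 1 ≤ n₀) {W : Finset (Site d)} (hW : box d n₀ ⊆ W) {t : Site d}
    (ht : t ∈ innerBoundary (zdGraph d) W) : t ∉ box d (n₀ - 1) := by
  classical
  intro htb
  obtain ⟨-, y, hyW, hty⟩ := mem_innerBoundary_iff.1 ht
  have hy : y ∈ box d (n₀ - 1 + 1) := DCT16.mem_box_succ_of_adj htb hty
  rw [Nat.sub_add_cancel hn₀] at hy
  exact hyW (hW hy)

/-! ## §2 The IIC along an arbitrary exhaustion -/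

/-- **KESTEN'S IIC DOES NOT DEPEND ON THE EXHAUSTION** (`d ≥ 1`, `0 < p`, `θ(p) = 0`, (A2)□ at aspect `(s,L)`, `s ≥ 2`, `ϰ > 0`): for every
probability measure `ν` with the IIC limit property (along the boxes `Λ(n)`), every sequence of finite vertex sets `W_n ⊇ Λ(r_n)` with
`r_n → ∞`, and every cylinder event `E`: **`P_p(E ∩ {0 ↔ ∂ⁱⁿW_n in W_n}) / P_p(0 ↔ ∂ⁱⁿW_n in W_n) → ν(E)`** — the conditionings
`{0 ↔ ∂ⁱⁿW in W}` are admissible in Basu–Sapozhnikov's sense (`exists_walk_to_innerBoundary_of_box_subset`), so the uniform clause of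
`iicMeasure_properties_of_setToSetQuasiMultAspectAt` applies. [cite: BasuSapozhnikov2017ECP, Thm. 1.1 and Remark 2.1] [cite: Kesten1986, Thm. (3)] -/
theorem iicMeasure_tendsto_cond_exhaustion (hd : 1 ≤ d) (p : unitInterval) (hp : 0 < (p : ℝ)) (hθ : theta (zdGraph d) 0 p = 0)
    {s L : ℕ} (hs : 2 ≤ s) {ϰ : ℝ} (hϰ : 0 < ϰ) (hA2 : SetToSetQuasiMultAspectAt d p s L ϰ)
    {ν : Measure (BondConfig (Site d))} [IsProbabilityMeasure ν]
    (hν : ∀ (F : Finset (Sym2 (Site d))) (E : Set (BondConfig (Site d))), MeasurableSet E → DeterminedBy E ↑F →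
      Tendsto (fun n : ℕ => (bondPercolation (zdGraph d) p).real (E ∩ siteToBoundary d n) / oneArmProb d p n)
        atTop (𝓝 (ν.real E)))
    (W : ℕ → Finset (Site d)) (r : ℕ → ℕ) (hr : Tendsto r atTop atTop) (hW : ∀ n, box d (r n) ⊆ W n)
    {F : Finset (Sym2 (Site d))} {E : Set (BondConfig (Site d))} (hEm : MeasurableSet E) (hE : DeterminedBy E ↑F) :
    Tendsto (fun n : ℕ =>
      (bondPercolation (zdGraph d) p).real
          (E ∩ {ω | ∃ t ∈ innerBoundary (zdGraph d) (W n), ω ∈ openConnIn (↑(W n) : Set (Site d)) 0 t}) /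
        (bondPercolation (zdGraph d) p).real
          {ω | ∃ t ∈ innerBoundary (zdGraph d) (W n), ω ∈ openConnIn (↑(W n) : Set (Site d)) 0 t})
      atTop (𝓝 (ν.real E)) := by
  classical
  obtain ⟨-, -, -, -, -, hunif⟩ := iicMeasure_properties_of_setToSetQuasiMultAspectAt hd p hp hθ hs hϰ hA2 hν
  rw [Metric.tendsto_nhds]
  intro ε hε
  obtain ⟨n₀, hn₀, hb⟩ := hunif F E hEm hE (ε / 2) (half_pos hε)
  filter_upwards [tendsto_atTop.1 hr n₀] with n hn
  have hWn : box d n₀ ⊆ W n := (box_mono d hn).trans (hW n)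
  have hT : innerBoundary (zdGraph d) (W n) ⊆ W n := fun t ht => (mem_innerBoundary_iff.1 ht).1
  have hTout : ∀ t ∈ innerBoundary (zdGraph d) (W n), t ∉ box d (n₀ - 1) := fun t ht =>
    not_mem_box_pred_of_mem_innerBoundary hn₀ hWn ht
  have hwalk : ∀ x ∈ innerBoundary (zdGraph d) (box d n₀), ∃ t ∈ innerBoundary (zdGraph d) (W n),
      ∃ q : (zdGraph d).Walk x t, ∀ z ∈ q.support, z ∈ (↑(W n) : Set (Site d)) \ ↑(box d (n₀ - 1)) := fun x hx =>
    exists_walk_to_innerBoundary_of_box_subset hn₀ hWn hx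
  have h := hb (W n) (innerBoundary (zdGraph d) (W n)) hWn hT hTout hwalk
  rw [Real.dist_eq]
  linarith

/-- **KESTEN'S IIC AT `p_c(ℤ^d)` DOES NOT DEPEND ON THE EXHAUSTION** (`d ≥ 2`, under (A2)□ at aspect `(s,L)`): for every `ν` with the IIC
limit property, all finite `W_n ⊇ Λ(r_n)` with `r_n → ∞` and every cylinder event `E`,
`P_{p_c}(E | 0 ↔ ∂ⁱⁿW_n in W_n) → ν(E)`. [cite: BasuSapozhnikov2017ECP, Thm. 1.1 and Remark 2.1] -/
theorem iicMeasure_tendsto_cond_exhaustion_criticalProbI (hd : 2 ≤ d) {s L : ℕ} (hs : 2 ≤ s) {ϰ : ℝ} (hϰ : 0 < ϰ)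
    (hA2 : SetToSetQuasiMultAspectAt d (criticalProbI d) s L ϰ)
    {ν : Measure (BondConfig (Site d))} [IsProbabilityMeasure ν]
    (hν : ∀ (F : Finset (Sym2 (Site d))) (E : Set (BondConfig (Site d))), MeasurableSet E → DeterminedBy E ↑F →
      Tendsto (fun n : ℕ => (bondPercolation (zdGraph d) (criticalProbI d)).real (E ∩ siteToBoundary d n) /
        oneArmProb d (criticalProbI d) n) atTop (𝓝 (ν.real E)))
    (W : ℕ → Finset (Site d)) (r : ℕ → ℕ) (hr : Tendsto r atTop atTop) (hW : ∀ n, box d (r n) ⊆ W n)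
    {F : Finset (Sym2 (Site d))} {E : Set (BondConfig (Site d))} (hEm : MeasurableSet E) (hE : DeterminedBy E ↑F) :
    Tendsto (fun n : ℕ =>
      (bondPercolation (zdGraph d) (criticalProbI d)).real
          (E ∩ {ω | ∃ t ∈ innerBoundary (zdGraph d) (W n), ω ∈ openConnIn (↑(W n) : Set (Site d)) 0 t}) /
        (bondPercolation (zdGraph d) (criticalProbI d)).real
          {ω | ∃ t ∈ innerBoundary (zdGraph d) (W n), ω ∈ openConnIn (↑(W n) : Set (Site d)) 0 t})
      atTop (𝓝 (ν.real E)) := by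
  have hpc : 0 < ((criticalProbI d : unitInterval) : ℝ) := by
    exact_mod_cast Literature.Barriers.CriticalPhenomena.criticalProbI_pos' (d := d) (by omega)
  exact iicMeasure_tendsto_cond_exhaustion (by omega) (criticalProbI d) hpc (CSH.percolationContinuity_allDimensions d hd) hs hϰ hA2
    hν W r hr hW hEm hE

/-- **KESTEN'S IIC ON `ℤ²` DOES NOT DEPEND ON THE EXHAUSTION, unconditionally**: for every probability measure `ν` with the IIC limit
property at `p_c(ℤ²) = 1/2`, all finite `W_n ⊇ Λ(r_n)` with `r_n → ∞` and every cylinder event `E`,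
`P_{1/2}(E | 0 ↔ ∂ⁱⁿW_n in W_n) → ν(E)` ((A2)□(9,77) from RSW, `θ(1/2) = 0` by Harris–Kesten).
[cite: BasuSapozhnikov2017ECP, Remark 2.1] [cite: Kesten1986, Thm. (3)] -/
theorem iicMeasure_tendsto_cond_exhaustion_Z2 {ν : Measure (BondConfig (Site 2))} [IsProbabilityMeasure ν]
    (hν : ∀ (F : Finset (Sym2 (Site 2))) (E : Set (BondConfig (Site 2))), MeasurableSet E → DeterminedBy E ↑F →
      Tendsto (fun n : ℕ => (bondPercolation (zdGraph 2) (criticalProbI 2)).real (E ∩ siteToBoundary 2 n) /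
        oneArmProb 2 (criticalProbI 2) n) atTop (𝓝 (ν.real E)))
    (W : ℕ → Finset (Site 2)) (r : ℕ → ℕ) (hr : Tendsto r atTop atTop) (hW : ∀ n, box 2 (r n) ⊆ W n)
    {F : Finset (Sym2 (Site 2))} {E : Set (BondConfig (Site 2))} (hEm : MeasurableSet E) (hE : DeterminedBy E ↑F) :
    Tendsto (fun n : ℕ =>
      (bondPercolation (zdGraph 2) (criticalProbI 2)).real
          (E ∩ {ω | ∃ t ∈ innerBoundary (zdGraph 2) (W n), ω ∈ openConnIn (↑(W n) : Set (Site 2)) 0 t}) /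
        (bondPercolation (zdGraph 2) (criticalProbI 2)).real
          {ω | ∃ t ∈ innerBoundary (zdGraph 2) (W n), ω ∈ openConnIn (↑(W n) : Set (Site 2)) 0 t})
      atTop (𝓝 (ν.real E)) := by
  obtain ⟨ϰ, hϰ, hA2⟩ := exists_setToSetQuasiMultAspectAt_two_of_criticalProbI_le
  exact iicMeasure_tendsto_cond_exhaustion (d := 2) (by norm_num) (criticalProbI 2) criticalProbI_two_pos
    (percolationContinuity_two kesten_criticalProb_Z2_holds harris_theta_half_holds) (s := 9) (L := 77) (by norm_num) hϰ
    (hA2 _ le_rfl) hν W r hr hW hEm hE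

end Summit.CriticalPhenomena.PercolationContinuityZ3.Theorems.Crossing

end
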